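import Summits.SmoothPoincare4.SmoothPoincare4.Theses.MinimalSphereMeanConvex
import Literature.Geometry.Riemannian.MeanConvexLevelSetFlow
import HarnessLib

/-!
# Birth skeleton (BC3) — crux `MinimalSphereMeanConvex.HorizonFreeSideTwoHandlebody`
# (stmt-SmoothPoincare4-5485)

Route `route-SmoothPoincare4-MinimalSphereMeanConvex`, crux #2 (rank 2, the ENGINE `E`)
`HorizonFreeSideTwoHandlebody`: in a connected Riemannian 4-manifold `(M, g)` every compact domain
`D = {φ₀ ≤ 0}` with smooth, connected, strictly mean-convex boundary `∂D = φ₀⁻¹(0) = f(N)` (outward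
unit normal `ν`, `dφ₀(ν) > 0`, `H > 0` in the tree's sign — the unit ball of `ℝ⁴` has `H = +3`) whose
interior contains no closed immersed minimal hypersurface carrying a unit normal ("horizon-free")
is a 2-handlebody: there is a Morse function `φ` on `M` with `{φ ≤ 0} = D`, `φ⁻¹(0) = φ₀⁻¹(0)` free
of critical points, and Morse index `≤ 2` at every critical point in `{φ < 0}`.

Skeleton registrar (planner one-shot `skel-stmt-SmoothPoincare4-5485`, 2026-08-17). THE LINE is the
route header's own two-layer plan for this node ("E ⇐ ExtinctionLemma → ArrivalTimeTwoHandlebody,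
once a `MeanConvexLevelSetFlow` / arrival-time definition exists") — that definition HAS landed
(`Literature/Geometry/Riemannian/MeanConvexLevelSetFlow.lean`: `IsWeakSetFlowIn`, `levelSetFlow` =
White's biggest weak set flow, `arrivalTime`, `extinctionTime`, `limitSet`, all REAL definitions
over exactly the crux's currency `PseudoRiemannianMetric (𝓡 (n+1)) …` with `n = 3`), so the node is
cut at the one quantity the mechanism runs on, the EXTINCTION TIME of the level set flow of `D`:

* `stub_extinction_of_horizonFree` (A, "ExtinctionLemma"; L): the crux's hypotheses (INCLUDING
  horizon-freeness) ⇒ `extinctionTime g {φ₀ ≤ 0} < ⊤`. White 2000: the mean-convex flow `K_t` is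
  nested and `K_t → K_∞`; for `n = 3 < 7` a nonempty `K_∞` has smooth compact embedded stable
  minimal boundary inside `{φ₀ < 0}` — a horizon (one-sided components through their orientation
  double covers, which is why the crux does not ask `f'` to be injective); so `K_∞ = ∅` and, by upper
  semicontinuity of the arrival time on the compact `D`, the extinction time is finite.
* `stub_twoHandlebody_of_extinction` (B, "ArrivalTimeTwoHandlebody"; XL, THE LOAD-BEARING STUB): the
  crux's hypotheses WITHOUT horizon-freeness, plus `extinctionTime g {φ₀ ≤ 0} < ⊤` ⇒ the crux's
  Morse conclusion. Colding–Minicozzi 2016 (arrival time twice differentiable, `Hess u = −(1/k)·P`,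
  `P` the projection onto a `(k+1)`-plane, at a singular point with tangent flow `S^k × ℝ^(3−k)`),
  White 2003/2013 (blow-ups of convex type only: `k ∈ {1,2,3}`, NO `S⁰ × ℝ³`; homotopy-level topology
  change), Choi–Haslhofer 2024 Cor. 1.3 (canonical neighbourhoods in 4-manifolds): backwards in time
  a `k`-singularity attaches a handle of index `3 − k ≤ 2`, so a Morse regularisation of `−u`
  (`= φ₀` near `∂D`) has indices `≤ 2` below `0`. The crux's own risk lives here: bubble-sheet
  (`k = 1`) strata are not isolated and `u` is not `C²`, so the Morse regularisation is not in print.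
* `horizonFreeSideTwoHandlebody_of_stubSigs : A-sig → B-sig → (crux body)` — THE REAL COMPOSITION,
  sorry-free (feed A's extinction time into B; pure logic).
* `HorizonFreeSideTwoHandlebody_of : HorizonFreeSideTwoHandlebody` — THE SKELETON THEOREM: the crux
  BY NAME from the two declared stubs through the composition (`ledger skeleton check` shape: no
  hypotheses; the file's only theorem whose head is the crux name).

`sorry` occurs ONLY in the two `stub_*` theorems (`lean check --json`: rc 0, errors [], sorries 2 =
stubs 2; audit: `horizonFreeSideTwoHandlebody_of_stubSigs` closed = true, `HorizonFreeSideTwoHandlebody_of`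
"proves …MinimalSphereMeanConvex.HorizonFreeSideTwoHandlebody (route_item); NOT closed: axioms
[sorryAx]" — i.e. sorry enters only through the stubs).

Hardest stub: `stub_twoHandlebody_of_extinction` (the Morse-level sharpening of White 2013 in
ambient dimension 4; A is vendoring of White 2000 over the tree's weak-set-flow vocabulary plus one
use of the horizon-free clause). Neither stub is bookkeeping: A needs short-time existence of the
barrier flows, avoidance/nesting, closedness of the biggest flow's track (Ilmanen 1992 / White 1995)
and White's long-time regularity; B is the open content.

## Disproof used

None exists: `ledger crux ls stmt-SmoothPoincare4-5485` shows no workfiles (no `Disproof.lean`, no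
dead lines, no landed `Negative/` lemma) and `ledger negatives --problem SmoothPoincare4` lists 0
refuted statements (2026-08-17) — no stub is an instance of a refuted statement. The refuter's route
review on the item (2026-08-15) certified the SIGN convention this skeleton inherits (mean-CONVEX:
`H = +3 > 0`, `dφ₀(ν) = 2 > 0` on the unit ball of `ℝ⁴`).

## BC3 probes (registrar, 2026-08-17; files `bc/probe_*.lean`, `bc/probe2_*.lean` in the seat folder)

For each stub `X ∈ {A, B}` and each target `T ∈ {HorizonFreeSideTwoHandlebody, SmoothPoincare4}`:
`set_option maxHeartbeats 400000 in example : X → T := by first | exact? | simpa [X] | (unfold X;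
simpa) | aesop` — all four FAIL (lean rc 1: deterministic timeout at `whnf`, 400000 heartbeats, no
branch closes the goal); per-tactic reruns: `exact?` "could not close the goal" (4/4), `aesop`
"failed to prove the goal after exhaustive search" (4/4), `simpa [X, T] using h` timeout / type
mismatch (4/4). No stub is cheaply the crux or the summit.

## References

* B. White, *The size of the singular set in mean curvature flow of mean-convex sets*, JAMS 13
  (2000), Thm. 1.1, §3 (Thm. 3.1), §5. [White2000]
* B. White, *The nature of singularities in mean curvature flow of mean-convex sets*, JAMS 16
  (2003). [White2002]  B. White, *Topological change in mean convex mean curvature flow*, Invent.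
  Math. 191 (2013), Thm. 1.1 (arXiv:1107.4644). [White2012]
* T. H. Colding, W. P. Minicozzi II, *Differentiability of the arrival time*, CPAM 69 (2016),
  Thm. 1.2 (arXiv:1501.07899). [ColdingMinicozzi2016]  *Regularity of the level set flow*, CPAM 71
  (2018). [ColdingMinicozzi2017]
* K. Choi, R. Haslhofer, Cor. 1.3 (canonical neighbourhoods of mean-convex flows in 4-manifolds).
  [ChoiHaslhofer2024]
* O. Hershkovits, B. White, CPAM 73 (2020), App. Def. 19, Thm. 20 (arXiv:1704.00431).
  [HershkovitsWhite2019]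
* T. Ilmanen, *Generalized flow of sets by mean curvature on a manifold*, Indiana Univ. Math. J. 41
  (1992). [Ilmanen1992]
* J. Milnor, *Morse theory* (1963), §3. [Milnor1963]
-/

noncomputable section

-- `Summit.<Summit>.<Problem>`: single-conjunct summit, the duplicate component is mandated (CONVENTIONS §2).
set_option linter.dupNamespace false
set_option linter.unusedVariables false

open scoped Manifold ContDiff Topology ENNReal

namespace Summit.SmoothPoincare4.SmoothPoincare4.Cruxes.HorizonFreeSideTwoHandlebody.Birth

/-! ## The two registered stubs -/

/-- **Stub A — EXTINCTION OF HORIZON-FREE MEAN-CONVEX DOMAINS** (White's long-time theorem, read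
through the horizon-free hypothesis). In a connected Riemannian 4-manifold `(M, g)` let
`D = {φ₀ ≤ 0}` be a compact domain with smooth, connected, strictly mean-convex boundary
`∂D = φ₀⁻¹(0) = f(N)` (outward unit normal `ν`, `dφ₀(ν) > 0`, `H > 0` in the tree's sign) whose
interior `{φ₀ < 0}` contains no closed immersed minimal hypersurface carrying a unit normal. Then
White's level set flow of `D` (`Literature.Geometry.Riemannian.levelSetFlow`, the biggest weak set
flow) goes EXTINCT IN FINITE TIME: `extinctionTime g D = sup_{x ∈ D} u(x) < ∞`, `u` the arrival time.
Why plausibly true: the flow `K_t` of a compact mean-convex set is nested and converges to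
`K_∞ = ⋂ K_t`; if `K_∞ ≠ ∅` then `∂K_∞` is a compact embedded STABLE MINIMAL hypersurface, smooth
because `n = 3 < 7` (White 2000, Thm. 1.1 and §§3, 5, long-time behaviour), lying in `{φ₀ < 0}`
(strict mean convexity moves `∂D` inwards at once) and nonempty (`∂K_∞ = ∅` would force
`K_∞ = M` by connectedness, impossible since `φ₀ > 0` somewhere near `∂D`); a two-sided component is
an injective immersion with a unit normal, a one-sided one is excluded through its orientation
double cover (an immersion with unit normal — injectivity is NOT assumed in the horizon-free
clause for exactly this reason). Hence `K_∞ = ∅`, `u < ∞` on `D`, and `u` is bounded by upper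
semicontinuity (closedness of the track of the biggest flow; Ilmanen 1992 / White 1995) and
compactness of `D`. Size: L (vendoring White 2000's structure theory over the tree's
`IsWeakSetFlowIn` / `levelSetFlow` / `arrivalTime`, incl. short-time existence of the barrier flows
and the avoidance/nesting lemmas; the Euclidean shadow `extinctionTime_lt_top_of_isBounded` is
proved in `LevelSetFlowExtinction.lean`). Sources: White2000 (JAMS 13, Thm. 1.1, §3 Thm. 3.1, §5),
HershkovitsWhite2019 (App. Def. 19, Thm. 20), Ilmanen1992, Frankel1966 (the route's use).
[cite: White2000, Thm. 1.1] -/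
theorem stub_extinction_of_horizonFree :
    ∀ (M : Type) [TopologicalSpace M] [T2Space M] [SecondCountableTopology M] [ConnectedSpace M]
      [ChartedSpace (EuclideanSpace ℝ (Fin 4)) M] [IsManifold (𝓡 4) ∞ M]
      (g : Literature.Geometry.Lorentzian.PseudoRiemannianMetric (𝓡 4) ∞ (EuclideanSpace ℝ (Fin 4))
        (TangentSpace (𝓡 4) : M → Type _)) [g.HasLeviCivita], g.IsRiemannian →
    ∀ (φ₀ : M → ℝ), ContMDiff (𝓡 4) 𝓘(ℝ, ℝ) ∞ φ₀ → IsCompact {x | φ₀ x ≤ 0} →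
    ∀ (N : Type) [TopologicalSpace N] [T2Space N] [SecondCountableTopology N] [CompactSpace N]
      [ConnectedSpace N] [ChartedSpace (EuclideanSpace ℝ (Fin 3)) N] [IsManifold (𝓡 3) ∞ N]
      (f : N → M) (hf : g.IsSpacelikeImmersion (𝓡 3) f)
      (ν : Literature.Geometry.Lorentzian.NormalField (𝓡 4) f),
      Function.Injective f → Set.range f = φ₀ ⁻¹' {0} → g.IsUnitNormal (𝓡 3) f ν 1 →
      ContMDiff (𝓡 3) (𝓡 4).tangent ∞
        (fun y ↦ (Bundle.TotalSpace.mk' (EuclideanSpace ℝ (Fin 4)) (f y) (ν y) :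
          TangentBundle (𝓡 4) M)) →
      (∀ y, 0 < (show ℝ from mfderiv (𝓡 4) 𝓘(ℝ, ℝ) φ₀ (f y) (ν y))) →
      (∀ y, 0 < g.meanCurvature f
        Literature.Geometry.Lorentzian.PseudoRiemannianMetric.contMDiff_pullbackBilin_holds hf ν y) →
      (∀ (N' : Type) [TopologicalSpace N'] [T2Space N'] [SecondCountableTopology N']
        [CompactSpace N'] [ConnectedSpace N'] [ChartedSpace (EuclideanSpace ℝ (Fin 3)) N']
        [IsManifold (𝓡 3) ∞ N'] (f' : N' → M) (hf' : g.IsSpacelikeImmersion (𝓡 3) f')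
        (ν' : Literature.Geometry.Lorentzian.NormalField (𝓡 4) f'),
        (∀ y, φ₀ (f' y) < 0) → g.IsUnitNormal (𝓡 3) f' ν' 1 →
        ContMDiff (𝓡 3) (𝓡 4).tangent ∞
          (fun y ↦ (Bundle.TotalSpace.mk' (EuclideanSpace ℝ (Fin 4)) (f' y) (ν' y) :
            TangentBundle (𝓡 4) M)) →
        ¬ g.IsMaximalSlice f'
          Literature.Geometry.Lorentzian.PseudoRiemannianMetric.contMDiff_pullbackBilin_holds hf' ν') →
      Literature.Geometry.Riemannian.extinctionTime g {x | φ₀ x ≤ 0} < ⊤ := by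
  sorry

/-- **Stub B — AN EXTINCT STRICTLY MEAN-CONVEX DOMAIN OF A RIEMANNIAN 4-MANIFOLD IS A
2-HANDLEBODY** (the Morse-level sharpening of White's topological theorem; the load-bearing stub).
Same `(M, g)`, `D = {φ₀ ≤ 0}`, `f`, `ν` as in Stub A but WITHOUT the horizon-free clause; instead the
level set flow of `D` is assumed extinct, `extinctionTime g D < ∞`. Conclusion: the crux's — a Morse
function `φ` on `M` with `{φ ≤ 0} = D`, `φ⁻¹(0) = φ₀⁻¹(0)` free of critical points, and Morse index
`≤ 2` at every critical point in `{φ < 0}` (`D` is a 4-dimensional 2-handlebody, Milnor 1963 §3).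
Why plausibly true: the flow sweeps out `D` monotonically, `K_t = {u ≥ t}`; the arrival time `u` is
twice differentiable, smooth off its compact critical set, with `Hess u = −(1/k)·(projection onto a
(k+1)-plane)` at a singular point whose tangent flow is the shrinking `S^k × ℝ^(3−k)`
(Colding–Minicozzi 2016, Thm. 1.2, in `ℝⁿ⁺¹`; the blow-ups of a mean-convex flow are of convex type,
`k ∈ {1, 2, 3}` only — NO `S⁰ × ℝ³` — White 2003/2013, with canonical neighbourhoods in 4-manifolds,
Choi–Haslhofer 2024, Cor. 1.3); read backwards in time a `k`-singularity is the attachment of a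
handle of index `3 − k ≤ 2`, so a Morse regularisation `φ` of `−u` (equal to `φ₀` near `∂D`, where
`u = 0` and the flow is smooth with `∂_t = −Hν`, `H > 0`) has only critical points of index `≤ 2`
below `0`. Why it might fail (the crux's own risk, concentrated here): bubble-sheet (`k = 1`)
singular strata are not isolated and `u` is not `C²`, so the Morse regularisation near a degenerate
singular stratum is not in print (White 2013 is homotopy-level; mean-convex surgery covers 2-convex
data only). Size: XL / open in print as a Morse statement. Sources: ColdingMinicozzi2016 (CPAM 69,
Thm. 1.2), ColdingMinicozzi2017/2018 (regularity of the level set flow), White2002 (JAMS 16),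
White2012 (Invent. 191, Thm. 1.1), ChoiHaslhofer2024 (Cor. 1.3), HaslhoferKleiner2017,
BrendleHuisken2017, Milnor1963 §3. [cite: White2012, Thm. 1.1] [cite: ColdingMinicozzi2016, Thm. 1.2] -/
theorem stub_twoHandlebody_of_extinction :
    ∀ (M : Type) [TopologicalSpace M] [T2Space M] [SecondCountableTopology M] [ConnectedSpace M]
      [ChartedSpace (EuclideanSpace ℝ (Fin 4)) M] [IsManifold (𝓡 4) ∞ M]
      (g : Literature.Geometry.Lorentzian.PseudoRiemannianMetric (𝓡 4) ∞ (EuclideanSpace ℝ (Fin 4))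
        (TangentSpace (𝓡 4) : M → Type _)) [g.HasLeviCivita], g.IsRiemannian →
    ∀ (φ₀ : M → ℝ), ContMDiff (𝓡 4) 𝓘(ℝ, ℝ) ∞ φ₀ → IsCompact {x | φ₀ x ≤ 0} →
    ∀ (N : Type) [TopologicalSpace N] [T2Space N] [SecondCountableTopology N] [CompactSpace N]
      [ConnectedSpace N] [ChartedSpace (EuclideanSpace ℝ (Fin 3)) N] [IsManifold (𝓡 3) ∞ N]
      (f : N → M) (hf : g.IsSpacelikeImmersion (𝓡 3) f)
      (ν : Literature.Geometry.Lorentzian.NormalField (𝓡 4) f),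
      Function.Injective f → Set.range f = φ₀ ⁻¹' {0} → g.IsUnitNormal (𝓡 3) f ν 1 →
      ContMDiff (𝓡 3) (𝓡 4).tangent ∞
        (fun y ↦ (Bundle.TotalSpace.mk' (EuclideanSpace ℝ (Fin 4)) (f y) (ν y) :
          TangentBundle (𝓡 4) M)) →
      (∀ y, 0 < (show ℝ from mfderiv (𝓡 4) 𝓘(ℝ, ℝ) φ₀ (f y) (ν y))) →
      (∀ y, 0 < g.meanCurvature f
        Literature.Geometry.Lorentzian.PseudoRiemannianMetric.contMDiff_pullbackBilin_holds hf ν y) →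
      Literature.Geometry.Riemannian.extinctionTime g {x | φ₀ x ≤ 0} < ⊤ →
      ∃ φ : M → ℝ, Literature.Topology.FourManifolds.IsMorse (𝓡 4) φ ∧
        {x | φ x ≤ 0} = {x | φ₀ x ≤ 0} ∧ φ ⁻¹' {0} = φ₀ ⁻¹' {0} ∧
        (∀ x, φ x = 0 → ¬ Literature.Topology.FourManifolds.IsMCriticalPt (𝓡 4) φ x) ∧
        (∀ x, Literature.Topology.FourManifolds.IsMCriticalPt (𝓡 4) φ x → φ x < 0 →
          Literature.Topology.FourManifolds.morseIndex (𝓡 4) φ x ≤ 2) := by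
  sorry

/-! ## The composition (sorry-free): the two stub statements imply the crux -/

/-- **Stub A and Stub B imply `HorizonFreeSideTwoHandlebody`** — the real assembly of the line (pure
logic: feed the extinction time produced by A into B). The conclusion is the crux's body verbatim
(so that `HorizonFreeSideTwoHandlebody_of` below is the file's only theorem whose head is the crux
name, the `ledger skeleton check` shape). [folklore] -/
theorem horizonFreeSideTwoHandlebody_of_stubSigs
    (hA : ∀ (M : Type) [TopologicalSpace M] [T2Space M] [SecondCountableTopology M] [ConnectedSpace M]
      [ChartedSpace (EuclideanSpace ℝ (Fin 4)) M] [IsManifold (𝓡 4) ∞ M]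
      (g : Literature.Geometry.Lorentzian.PseudoRiemannianMetric (𝓡 4) ∞ (EuclideanSpace ℝ (Fin 4))
        (TangentSpace (𝓡 4) : M → Type _)) [g.HasLeviCivita], g.IsRiemannian →
    ∀ (φ₀ : M → ℝ), ContMDiff (𝓡 4) 𝓘(ℝ, ℝ) ∞ φ₀ → IsCompact {x | φ₀ x ≤ 0} →
    ∀ (N : Type) [TopologicalSpace N] [T2Space N] [SecondCountableTopology N] [CompactSpace N]
      [ConnectedSpace N] [ChartedSpace (EuclideanSpace ℝ (Fin 3)) N] [IsManifold (𝓡 3) ∞ N]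
      (f : N → M) (hf : g.IsSpacelikeImmersion (𝓡 3) f)
      (ν : Literature.Geometry.Lorentzian.NormalField (𝓡 4) f),
      Function.Injective f → Set.range f = φ₀ ⁻¹' {0} → g.IsUnitNormal (𝓡 3) f ν 1 →
      ContMDiff (𝓡 3) (𝓡 4).tangent ∞
        (fun y ↦ (Bundle.TotalSpace.mk' (EuclideanSpace ℝ (Fin 4)) (f y) (ν y) :
          TangentBundle (𝓡 4) M)) →
      (∀ y, 0 < (show ℝ from mfderiv (𝓡 4) 𝓘(ℝ, ℝ) φ₀ (f y) (ν y))) →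
      (∀ y, 0 < g.meanCurvature f
        Literature.Geometry.Lorentzian.PseudoRiemannianMetric.contMDiff_pullbackBilin_holds hf ν y) →
      (∀ (N' : Type) [TopologicalSpace N'] [T2Space N'] [SecondCountableTopology N']
        [CompactSpace N'] [ConnectedSpace N'] [ChartedSpace (EuclideanSpace ℝ (Fin 3)) N']
        [IsManifold (𝓡 3) ∞ N'] (f' : N' → M) (hf' : g.IsSpacelikeImmersion (𝓡 3) f')
        (ν' : Literature.Geometry.Lorentzian.NormalField (𝓡 4) f'),
        (∀ y, φ₀ (f' y) < 0) → g.IsUnitNormal (𝓡 3) f' ν' 1 →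
        ContMDiff (𝓡 3) (𝓡 4).tangent ∞
          (fun y ↦ (Bundle.TotalSpace.mk' (EuclideanSpace ℝ (Fin 4)) (f' y) (ν' y) :
            TangentBundle (𝓡 4) M)) →
        ¬ g.IsMaximalSlice f'
          Literature.Geometry.Lorentzian.PseudoRiemannianMetric.contMDiff_pullbackBilin_holds hf' ν') →
      Literature.Geometry.Riemannian.extinctionTime g {x | φ₀ x ≤ 0} < ⊤)
    (hB : ∀ (M : Type) [TopologicalSpace M] [T2Space M] [SecondCountableTopology M] [ConnectedSpace M]
      [ChartedSpace (EuclideanSpace ℝ (Fin 4)) M] [IsManifold (𝓡 4) ∞ M]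
      (g : Literature.Geometry.Lorentzian.PseudoRiemannianMetric (𝓡 4) ∞ (EuclideanSpace ℝ (Fin 4))
        (TangentSpace (𝓡 4) : M → Type _)) [g.HasLeviCivita], g.IsRiemannian →
    ∀ (φ₀ : M → ℝ), ContMDiff (𝓡 4) 𝓘(ℝ, ℝ) ∞ φ₀ → IsCompact {x | φ₀ x ≤ 0} →
    ∀ (N : Type) [TopologicalSpace N] [T2Space N] [SecondCountableTopology N] [CompactSpace N]
      [ConnectedSpace N] [ChartedSpace (EuclideanSpace ℝ (Fin 3)) N] [IsManifold (𝓡 3) ∞ N]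
      (f : N → M) (hf : g.IsSpacelikeImmersion (𝓡 3) f)
      (ν : Literature.Geometry.Lorentzian.NormalField (𝓡 4) f),
      Function.Injective f → Set.range f = φ₀ ⁻¹' {0} → g.IsUnitNormal (𝓡 3) f ν 1 →
      ContMDiff (𝓡 3) (𝓡 4).tangent ∞
        (fun y ↦ (Bundle.TotalSpace.mk' (EuclideanSpace ℝ (Fin 4)) (f y) (ν y) :
          TangentBundle (𝓡 4) M)) →
      (∀ y, 0 < (show ℝ from mfderiv (𝓡 4) 𝓘(ℝ, ℝ) φ₀ (f y) (ν y))) →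
      (∀ y, 0 < g.meanCurvature f
        Literature.Geometry.Lorentzian.PseudoRiemannianMetric.contMDiff_pullbackBilin_holds hf ν y) →
      Literature.Geometry.Riemannian.extinctionTime g {x | φ₀ x ≤ 0} < ⊤ →
      ∃ φ : M → ℝ, Literature.Topology.FourManifolds.IsMorse (𝓡 4) φ ∧
        {x | φ x ≤ 0} = {x | φ₀ x ≤ 0} ∧ φ ⁻¹' {0} = φ₀ ⁻¹' {0} ∧
        (∀ x, φ x = 0 → ¬ Literature.Topology.FourManifolds.IsMCriticalPt (𝓡 4) φ x) ∧
        (∀ x, Literature.Topology.FourManifolds.IsMCriticalPt (𝓡 4) φ x → φ x < 0 →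
          Literature.Topology.FourManifolds.morseIndex (𝓡 4) φ x ≤ 2)) :
    ∀ (M : Type) [TopologicalSpace M] [T2Space M] [SecondCountableTopology M] [ConnectedSpace M]
      [ChartedSpace (EuclideanSpace ℝ (Fin 4)) M] [IsManifold (𝓡 4) ∞ M]
      (g : Literature.Geometry.Lorentzian.PseudoRiemannianMetric (𝓡 4) ∞ (EuclideanSpace ℝ (Fin 4))
        (TangentSpace (𝓡 4) : M → Type _)) [g.HasLeviCivita], g.IsRiemannian →
    ∀ (φ₀ : M → ℝ), ContMDiff (𝓡 4) 𝓘(ℝ, ℝ) ∞ φ₀ → IsCompact {x | φ₀ x ≤ 0} →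
    ∀ (N : Type) [TopologicalSpace N] [T2Space N] [SecondCountableTopology N] [CompactSpace N]
      [ConnectedSpace N] [ChartedSpace (EuclideanSpace ℝ (Fin 3)) N] [IsManifold (𝓡 3) ∞ N]
      (f : N → M) (hf : g.IsSpacelikeImmersion (𝓡 3) f)
      (ν : Literature.Geometry.Lorentzian.NormalField (𝓡 4) f),
      Function.Injective f → Set.range f = φ₀ ⁻¹' {0} → g.IsUnitNormal (𝓡 3) f ν 1 →
      ContMDiff (𝓡 3) (𝓡 4).tangent ∞
        (fun y ↦ (Bundle.TotalSpace.mk' (EuclideanSpace ℝ (Fin 4)) (f y) (ν y) :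
          TangentBundle (𝓡 4) M)) →
      (∀ y, 0 < (show ℝ from mfderiv (𝓡 4) 𝓘(ℝ, ℝ) φ₀ (f y) (ν y))) →
      (∀ y, 0 < g.meanCurvature f
        Literature.Geometry.Lorentzian.PseudoRiemannianMetric.contMDiff_pullbackBilin_holds hf ν y) →
      (∀ (N' : Type) [TopologicalSpace N'] [T2Space N'] [SecondCountableTopology N']
        [CompactSpace N'] [ConnectedSpace N'] [ChartedSpace (EuclideanSpace ℝ (Fin 3)) N']
        [IsManifold (𝓡 3) ∞ N'] (f' : N' → M) (hf' : g.IsSpacelikeImmersion (𝓡 3) f')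
        (ν' : Literature.Geometry.Lorentzian.NormalField (𝓡 4) f'),
        (∀ y, φ₀ (f' y) < 0) → g.IsUnitNormal (𝓡 3) f' ν' 1 →
        ContMDiff (𝓡 3) (𝓡 4).tangent ∞
          (fun y ↦ (Bundle.TotalSpace.mk' (EuclideanSpace ℝ (Fin 4)) (f' y) (ν' y) :
            TangentBundle (𝓡 4) M)) →
        ¬ g.IsMaximalSlice f'
          Literature.Geometry.Lorentzian.PseudoRiemannianMetric.contMDiff_pullbackBilin_holds hf' ν') →
      ∃ φ : M → ℝ, Literature.Topology.FourManifolds.IsMorse (𝓡 4) φ ∧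
        {x | φ x ≤ 0} = {x | φ₀ x ≤ 0} ∧ φ ⁻¹' {0} = φ₀ ⁻¹' {0} ∧
        (∀ x, φ x = 0 → ¬ Literature.Topology.FourManifolds.IsMCriticalPt (𝓡 4) φ x) ∧
        (∀ x, Literature.Topology.FourManifolds.IsMCriticalPt (𝓡 4) φ x → φ x < 0 →
          Literature.Topology.FourManifolds.morseIndex (𝓡 4) φ x ≤ 2) := by
  intro M _ _ _ _ _ _ g _ hRiem φ₀ hφ₀ hD N _ _ _ _ _ _ _ f hf ν hinj hrange hunit hνs hout hH hHF
  exact hB M g hRiem φ₀ hφ₀ hD N f hf ν hinj hrange hunit hνs hout hH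
    (hA M g hRiem φ₀ hφ₀ hD N f hf ν hinj hrange hunit hνs hout hH hHF)

/-! ## The skeleton theorem -/

/-- **THE SKELETON THEOREM: `MinimalSphereMeanConvex.HorizonFreeSideTwoHandlebody` BY NAME from the
two declared stubs** (`ledger skeleton check` shape: no hypotheses; `sorry` enters only through
`stub_extinction_of_horizonFree` and `stub_twoHandlebody_of_extinction`). [folklore] -/
theorem HorizonFreeSideTwoHandlebody_of :
    Summit.SmoothPoincare4.SmoothPoincare4.Theses.MinimalSphereMeanConvex.HorizonFreeSideTwoHandlebody :=
  horizonFreeSideTwoHandlebody_of_stubSigs stub_extinction_of_horizonFree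
    stub_twoHandlebody_of_extinction

end Summit.SmoothPoincare4.SmoothPoincare4.Cruxes.HorizonFreeSideTwoHandlebody.Birth

end
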